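import Literature.NumberTheory.DiophantineGeometry.GenEllDeRamificationArch
import Literature.NumberTheory.DiophantineGeometry.GenEllDeCriticalCollisions
import HarnessLib

/-!
# The ramification form `N_c` of the FAMILY `t_c = 1/r + c·r^{k+1}/s` on `D_e : r^e = x(1−x)`:
# archimedean lower bound under separation from its zeros
# ([GenEll] Thm. 2.1 (ii) ⇒ (i), archimedean bookkeeping — the `c`-parametric twin of
# `GenEllDeRamificationArch`; number-field and height forms in `GenEllDeRamificationArchFamilyHeight`)

S. Mochizuki, *Arithmetic elliptic curves in general position*, Math. J. Okayama Univ. **52** (2010)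
[cite: MochizukiGenEll2010, Thm 2.1 p.12]: in the proof of Thm. 2.1, (ii) ⇒ (i) (kurims pp. 12–13) the
archimedean contribution to the height/conductor comparison on the auxiliary curve is controlled by
"the compactness of the set of rational points of `X` over any finite extension of `ℚ_v` for
`v ∈ V`" (p. 12).  In the number-field-only rendering of that proof used by the abc-iut cell for
`(X, D) = (ℙ¹, [0]+[1]+[∞])` (route item `Summit.ABC.ABC.Theses.IUTThetaPilot.GenEllTwo`; package map
GENELLTWO-P1ROUTE §3 (d), package W5b; OWNER RULING #6 and its amendment: the per-configuration
protection varies the function `t`) the auxiliary curve is the cyclic cover `D_e : r^e = x(1 − x)`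
(`e = 2k+1`), `s := 1 − 2x`, and the FAMILY of functions is `t_c := 1/r + c·r^{k+1}/s` (`c ≠ 0`),
whose ramification on the affine part is cut out by

  `N_c := r²s³ · dt_c/dr = −(1−2x)³ + c·((k+1)·r^{k+2} − 2·r^{3k+3})`

(the tree's `DeFamily.N k c`, `GenEllDeCriticalCollisions.lean`; `c = 1` is `DeArch.N` of
`GenEllDeRamificationArch.lean`, see `DeFamily.N_one`).  This PROOF-ONLY file is the `c`-parametric
twin of `GenEllDeRamificationArch.lean` (same proofs with `c` threaded through; the threshold of the
growth lemma becomes `6 + 23/‖c‖`):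

* GROWTH (`norm_snd_lt_of_norm_N_le_one`, `norm_fst_le_of_norm_N_le_one`): for `c ≠ 0`, on `D_e(ℂ)`,
  `‖N_c(P)‖ ≤ 1 ⇒ ‖r‖ < 6 + 23/‖c‖ ∧ ‖x‖ ≤ (6 + 23/‖c‖)^e` (for `‖r‖ ≥ 6 + 23/‖c‖`:
  `‖s‖⁶ ≤ 125‖r‖^{6k+3} < (‖c‖·‖A‖ − 1)²` with `A := (k+1)r^{k+2} − 2r^{3k+3}`, `‖A‖ ≥ ‖r‖^{3k+3}`,
  whence `‖N_c‖ ≥ ‖c‖·‖A‖ − ‖s‖³ > 1`);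
* COMPACTNESS (`isCompact_sublevel`): `{P ∈ D_e(ℂ) | ‖N_c(P)‖ ≤ 1}` is compact (`c ≠ 0`);
* LOWER BOUND (`exists_pos_le_norm_N_of_separated`): `∀ ρ > 0 ∃ δ > 0`, every `P ∈ D_e(ℂ)` at
  sup-distance `≥ ρ` from all zeros of `N_c` on `D_e(ℂ)` has `‖N_c(P)‖ ≥ δ`; monotone variant
  `…_of_subset`; `x`-currency reduction `separated_of_fst_separated` /
  `exists_pos_le_norm_N_of_fst_separated` (if every zero of `N_c` on `D_e(ℂ)` has `x`-coordinate in
  a set `X ⊆ ℂ` — e.g. `X_φ = x(t_c⁻¹ B)` of the spine — then `ρ`-separation of `x` from `X`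
  suffices).

The number-field forms (`Σ_σ log⁺ ‖σ(N_c(x,r))‖⁻¹ ≤ [K:ℚ]·C` for `c ∈ ℚ^×`) and the height form are in
the companion `GenEllDeRamificationArchFamilyHeight.lean`.  Everything is proved; no definitions, no
named facts (the form `N_c` and the curve are the tree's `DeFamily.N` and `DeArch.curve`, consumed BY
NAME).  Classical and undisputed; nothing here refers to the disputed parts of the abc-iut corpus.
Deliberately NOT here: the identification of the zeros of `N_c` with the critical points of `t_c`
and `x(R_{t_c}) ⊆ X_φ` (family versions of `GenEllDeCriticalLocus` / `GenEllDeCriticalValues`), the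
good-prime multiplicity inequality (`GenEllDeFamilyGoodPrimes`), heights of `t_c`, `N_c` (W4a), the
`p`-adic side.
-/

noncomputable section

open Real

namespace Literature.NumberTheory.DiophantineGeometry.GenEll

namespace DeFamily

/-! ### The ramification form `N_c` of the family: algebra -/

section Algebra

variable {R S : Type*} [Field R] [Field S]

/-- `DeFamily.OnCurve k P` is membership in `DeArch.curve` (same equation `r^{2k+1} = x(1−x)`).
[cite: MochizukiGenEll2010, Thm 2.1 p.12] -/
theorem onCurve_iff_mem_curve {k : ℕ} {P : R × R} : OnCurve k P ↔ P ∈ DeArch.curve R k := Iff.rfl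

/-- `N_c` commutes with ring homomorphisms: `f(N_c(x, r)) = N_{f c}(f x, f r)` (so
`σ(N_c(P)) = N_{σ c}(σ P)` for every embedding `σ`). [cite: MochizukiGenEll2010, Thm 2.1 p.12] -/
theorem map_N (f : R →+* S) (k : ℕ) (c x r : R) :
    f (N k c (x, r)) = N k (f c) (f x, f r) := by
  simp [N, map_sub, map_add, map_neg, map_mul, map_pow, map_natCast, map_ofNat]

/-- Point form of `map_N`. [cite: MochizukiGenEll2010, Thm 2.1 p.12] -/
theorem map_N' (f : R →+* S) (k : ℕ) (c : R) (P : R × R) :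
    f (N k c P) = N k (f c) (f P.1, f P.2) :=
  map_N f k c P.1 P.2

/-- For `c ∈ ℚ` the parameter is fixed by every ring homomorphism: `f(N_c(x, r)) = N_c(f x, f r)`.
[cite: MochizukiGenEll2010, Thm 2.1 p.12] -/
theorem map_N_ratCast (f : R →+* S) (k : ℕ) (c : ℚ) (x r : R) :
    f (N k (c : R) (x, r)) = N k (c : S) (f x, f r) := by
  rw [map_N, map_ratCast]

/-- `N_c = c·A − s³` with `A := (k+1)r^{k+2} − 2r^{3k+3}`, `s = 1 − 2x`.
[cite: MochizukiGenEll2010, Thm 2.1 p.12] -/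
theorem N_eq_mul_sub (k : ℕ) (c : R) (P : R × R) :
    N k c P = c * (((k : R) + 1) * P.2 ^ (k + 2) - 2 * P.2 ^ (3 * k + 3)) - (1 - 2 * P.1) ^ 3 := by
  unfold N; ring

/-- The member `c = 1` of the family is the ramification form `DeArch.N` of `t = 1/r + r^{k+1}/s`.
[cite: MochizukiGenEll2010, Thm 2.1 p.12] -/
theorem N_one (k : ℕ) (P : R × R) : N k 1 P = DeArch.N k P.1 P.2 := by
  unfold N DeArch.N; ring

end Algebra

/-! ### Growth of `N_c` along `D_e(ℂ)` -/

section Complex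

variable {k : ℕ}

/-- GROWTH: for `c ≠ 0`, on `D_e(ℂ)`, `‖N_c(P)‖ ≤ 1` forces `‖r‖ < 6 + 23/‖c‖`.
[cite: MochizukiGenEll2010, Thm 2.1 p.12] -/
theorem norm_snd_lt_of_norm_N_le_one {c : ℂ} (hc : c ≠ 0) {P : ℂ × ℂ}
    (hP : P ∈ DeArch.curve ℂ k) (hN : ‖N k c P‖ ≤ 1) : ‖P.2‖ < 6 + 23 / ‖c‖ := by
  by_contra h6
  rw [not_lt] at h6
  set x := P.1
  set r := P.2
  set Rr : ℝ := ‖r‖ with hRr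
  set γ : ℝ := ‖c‖ with hγ
  have hγ0 : 0 < γ := norm_pos_iff.mpr hc
  set s : ℂ := 1 - 2 * x with hs
  set A : ℂ := ((k : ℂ) + 1) * r ^ (k + 2) - 2 * r ^ (3 * k + 3) with hA
  have h23 : 0 < 23 / γ := div_pos (by norm_num) hγ0
  have hR6 : (6 : ℝ) ≤ Rr := by linarith
  have hR2 : (2 : ℝ) ≤ Rr := by linarith
  have hR1 : (1 : ℝ) ≤ Rr := by linarith
  have hR0 : (0 : ℝ) ≤ Rr := by linarith
  -- (a) `γ · R ≥ 23`
  have hγR : 23 ≤ γ * Rr := by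
    have h1 : 23 / γ ≤ Rr := by linarith
    have h2 := (div_le_iff₀ hγ0).mp h1
    linarith [mul_comm Rr γ]
  -- (b) lower bound for `‖A‖`
  have hA1 : ‖(2 : ℂ) * r ^ (3 * k + 3)‖ = 2 * Rr ^ (3 * k + 3) := by
    rw [norm_mul, norm_pow, Complex.norm_ofNat]
  have hA2 : ‖((k : ℂ) + 1) * r ^ (k + 2)‖ = ((k : ℝ) + 1) * Rr ^ (k + 2) := by
    rw [norm_mul, norm_pow]
    congr 1
    have : ((k : ℂ) + 1) = ((k + 1 : ℕ) : ℂ) := by push_cast; ring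
    rw [this, Complex.norm_natCast, Nat.cast_add, Nat.cast_one]
  have hAlow : 2 * Rr ^ (3 * k + 3) - ((k : ℝ) + 1) * Rr ^ (k + 2) ≤ ‖A‖ := by
    have := norm_sub_norm_le ((2 : ℂ) * r ^ (3 * k + 3)) (((k : ℂ) + 1) * r ^ (k + 2))
    rw [hA1, hA2] at this
    have hAA : ‖A‖ = ‖(2 : ℂ) * r ^ (3 * k + 3) - ((k : ℂ) + 1) * r ^ (k + 2)‖ := by
      rw [show A = -((2 : ℂ) * r ^ (3 * k + 3) - ((k : ℂ) + 1) * r ^ (k + 2)) by rw [hA]; ring,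
        norm_neg]
    linarith
  have haux := DeArch.pow_aux hR2 k
  have hAu : Rr ^ (3 * k + 3) ≤ ‖A‖ := by linarith
  -- (c) upper bound for `‖s‖^6`
  have hs2 : s ^ 2 = 1 - 4 * r ^ (2 * k + 1) := DeArch.sq_sub_eq hP
  have hs6 : ‖s‖ ^ 6 ≤ 125 * Rr ^ (6 * k + 3) := by
    have h1 : ‖s‖ ^ 6 = ‖1 - 4 * r ^ (2 * k + 1)‖ ^ 3 := by
      rw [← hs2, norm_pow]; ring
    have h2 : ‖(1 : ℂ) - 4 * r ^ (2 * k + 1)‖ ≤ 5 * Rr ^ (2 * k + 1) := by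
      have h21 : ‖(1 : ℂ) - 4 * r ^ (2 * k + 1)‖ ≤ 1 + 4 * Rr ^ (2 * k + 1) := by
        refine (norm_sub_le _ _).trans ?_
        rw [norm_one, norm_mul, norm_pow, Complex.norm_ofNat]
      have h22 : (1 : ℝ) ≤ Rr ^ (2 * k + 1) := one_le_pow₀ hR1
      linarith
    have h3 : ‖(1 : ℂ) - 4 * r ^ (2 * k + 1)‖ ^ 3 ≤ (5 * Rr ^ (2 * k + 1)) ^ 3 :=
      pow_le_pow_left₀ (norm_nonneg _) h2 3
    have h4 : (5 * Rr ^ (2 * k + 1)) ^ 3 = 125 * Rr ^ (6 * k + 3) := by ring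
    rw [h1]; linarith
  -- (d) `γ‖A‖ − 1 ≥ γ R^{3k+3}/2 ≥ 0`
  have hcA : ‖c * A‖ = γ * ‖A‖ := norm_mul _ _
  have hu1 : (1 : ℝ) ≤ Rr ^ (3 * k + 2) := one_le_pow₀ hR1
  have hγu : 23 ≤ γ * Rr ^ (3 * k + 3) := by
    have h1 : γ * Rr ^ (3 * k + 3) = (γ * Rr) * Rr ^ (3 * k + 2) := by ring
    rw [h1]
    nlinarith
  have hγA : γ * Rr ^ (3 * k + 3) ≤ γ * ‖A‖ := mul_le_mul_of_nonneg_left hAu hγ0.le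
  have hm1 : γ * Rr ^ (3 * k + 3) / 2 ≤ γ * ‖A‖ - 1 := by linarith
  have hm0' : (0 : ℝ) ≤ γ * Rr ^ (3 * k + 3) / 2 := by positivity
  have hm0 : (0 : ℝ) ≤ γ * ‖A‖ - 1 := hm0'.trans hm1
  -- (e) `125 R^{6k+3} < (γ R^{3k+3}/2)² ≤ (γ‖A‖ − 1)²`
  have hlt : 125 * Rr ^ (6 * k + 3) < (γ * ‖A‖ - 1) ^ 2 := by
    have h1 : (γ * Rr ^ (3 * k + 3) / 2) ^ 2 = (γ * Rr) ^ 2 * Rr * Rr ^ (6 * k + 3) / 4 := by ring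
    have h2 : (529 : ℝ) ≤ (γ * Rr) ^ 2 := by nlinarith
    have hp : (0 : ℝ) < Rr ^ (6 * k + 3) := pow_pos (by linarith) _
    have h4 : (529 : ℝ) * 6 ≤ (γ * Rr) ^ 2 * Rr := by nlinarith
    have h3 : 125 * Rr ^ (6 * k + 3) < (γ * Rr ^ (3 * k + 3) / 2) ^ 2 := by
      rw [h1]
      nlinarith
    have h5 : (γ * Rr ^ (3 * k + 3) / 2) ^ 2 ≤ (γ * ‖A‖ - 1) ^ 2 :=
      pow_le_pow_left₀ hm0' hm1 2
    linarith
  -- (f) hence `‖s‖³ < γ‖A‖ − 1`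
  have hs3 : ‖s‖ ^ 3 < γ * ‖A‖ - 1 := by
    have : (‖s‖ ^ 3) ^ 2 < (γ * ‖A‖ - 1) ^ 2 := by
      have h : (‖s‖ ^ 3) ^ 2 = ‖s‖ ^ 6 := by ring
      rw [h]; linarith
    exact lt_of_pow_lt_pow_left₀ 2 hm0 this
  -- (g) `‖N_c‖ ≥ ‖cA‖ − ‖s‖³ > 1`
  have hNeq : N k c P = c * A - s ^ 3 := by rw [N_eq_mul_sub]
  have hNlow : ‖c * A‖ - ‖s‖ ^ 3 ≤ ‖N k c P‖ := by
    rw [hNeq, ← norm_pow]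
    exact norm_sub_norm_le _ _
  rw [hcA] at hNlow
  linarith

/-- GROWTH: for `c ≠ 0`, on `D_e(ℂ)`, `‖N_c(P)‖ ≤ 1` forces `‖x‖ ≤ (6 + 23/‖c‖)^e`.
[cite: MochizukiGenEll2010, Thm 2.1 p.12] -/
theorem norm_fst_le_of_norm_N_le_one {c : ℂ} (hc : c ≠ 0) {P : ℂ × ℂ}
    (hP : P ∈ DeArch.curve ℂ k) (hN : ‖N k c P‖ ≤ 1) :
    ‖P.1‖ ≤ (6 + 23 / ‖c‖) ^ (2 * k + 1) := by
  have hr := norm_snd_lt_of_norm_N_le_one hc hP hN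
  have hR₀ : (6 : ℝ) ≤ 6 + 23 / ‖c‖ := by
    have : (0 : ℝ) ≤ 23 / ‖c‖ := by positivity
    linarith
  have heq : ‖P.1‖ * ‖1 - P.1‖ = ‖P.2‖ ^ (2 * k + 1) := by
    rw [← norm_mul, ← norm_pow, (DeArch.mem_curve_iff.mp hP)]
  have hpow : ‖P.2‖ ^ (2 * k + 1) < (6 + 23 / ‖c‖) ^ (2 * k + 1) :=
    pow_lt_pow_left₀ hr (norm_nonneg _) (by omega)
  have h6 : (6 : ℝ) ≤ (6 + 23 / ‖c‖) ^ (2 * k + 1) := by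
    calc (6 : ℝ) ≤ 6 + 23 / ‖c‖ := hR₀
      _ = (6 + 23 / ‖c‖) ^ 1 := (pow_one _).symm
      _ ≤ (6 + 23 / ‖c‖) ^ (2 * k + 1) := pow_le_pow_right₀ (by linarith) (by omega)
  by_cases hx : ‖P.1‖ ≤ 2
  · linarith
  · rw [not_le] at hx
    have h1 : 1 ≤ ‖1 - P.1‖ := by
      have := norm_sub_norm_le P.1 1
      rw [norm_one] at this
      have h' : ‖P.1 - 1‖ = ‖1 - P.1‖ := norm_sub_rev _ _
      linarith
    have : ‖P.1‖ ≤ ‖P.1‖ * ‖1 - P.1‖ := by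
      nlinarith [norm_nonneg P.1]
    linarith

/-! ### Compactness of the sublevel set and the lower bound -/

/-- `N_c` is continuous on `ℂ × ℂ`. [cite: MochizukiGenEll2010, Thm 2.1 p.12] -/
theorem continuous_N (k : ℕ) (c : ℂ) : Continuous fun P : ℂ × ℂ => N k c P := by
  unfold N; fun_prop

/-- COMPACTNESS: for `c ≠ 0` the sublevel set `{P ∈ D_e(ℂ) | ‖N_c(P)‖ ≤ 1}` is compact ("the
compactness of the set of rational points … over any finite extension of `ℚ_v`", here `v = ∞`).
[cite: MochizukiGenEll2010, Thm 2.1 p.12] -/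
theorem isCompact_sublevel (k : ℕ) {c : ℂ} (hc : c ≠ 0) :
    IsCompact {P : ℂ × ℂ | P ∈ DeArch.curve ℂ k ∧ ‖N k c P‖ ≤ 1} := by
  refine Metric.isCompact_of_isClosed_isBounded ?_ ?_
  · exact (DeArch.isClosed_curve k).inter
      (isClosed_le (continuous_norm.comp (continuous_N k c)) continuous_const)
  · refine (Metric.isBounded_closedBall (x := (0 : ℂ × ℂ))
      (r := (6 + 23 / ‖c‖) ^ (2 * k + 1))).subset ?_
    intro P hP
    rw [Metric.mem_closedBall, dist_zero_right, Prod.norm_def]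
    refine max_le (norm_fst_le_of_norm_N_le_one hc hP.1 hP.2)
      ((norm_snd_lt_of_norm_N_le_one hc hP.1 hP.2).le.trans ?_)
    have hR₀ : (1 : ℝ) ≤ 6 + 23 / ‖c‖ := by
      have : (0 : ℝ) ≤ 23 / ‖c‖ := by positivity
      linarith
    calc (6 : ℝ) + 23 / ‖c‖ = (6 + 23 / ‖c‖) ^ 1 := (pow_one _).symm
      _ ≤ (6 + 23 / ‖c‖) ^ (2 * k + 1) := pow_le_pow_right₀ hR₀ (by omega)

/-- LOWER BOUND UNDER SEPARATION: for `c ≠ 0` and every `ρ > 0` there is `δ > 0` such that every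
point `P` of `D_e(ℂ)` lying at sup-distance `≥ ρ` from all zeros of `N_c` on `D_e(ℂ)` satisfies
`‖N_c(P)‖ ≥ δ` — the archimedean term of the height of `N_c(P)` is bounded under `ρ`-separation of
the conjugates from the ramification points of `t_c`. [cite: MochizukiGenEll2010, Thm 2.1 p.12] -/
theorem exists_pos_le_norm_N_of_separated (k : ℕ) {c : ℂ} (hc : c ≠ 0) {ρ : ℝ} (hρ : 0 < ρ) :
    ∃ δ : ℝ, 0 < δ ∧ ∀ P ∈ DeArch.curve ℂ k,
      (∀ Q ∈ DeArch.curve ℂ k, N k c Q = 0 → ρ ≤ dist P Q) → δ ≤ ‖N k c P‖ := by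
  classical
  have hclosed :
      IsClosed {P : ℂ × ℂ | ∀ Q ∈ DeArch.curve ℂ k, N k c Q = 0 → ρ ≤ dist P Q} := by
    rw [Set.setOf_forall]
    refine isClosed_iInter fun Q => ?_
    by_cases hQ : Q ∈ DeArch.curve ℂ k ∧ N k c Q = 0
    · have hQ' : {P : ℂ × ℂ | Q ∈ DeArch.curve ℂ k → N k c Q = 0 → ρ ≤ dist P Q} =
          {P | ρ ≤ dist P Q} := by
        ext P
        simp only [Set.mem_setOf_eq]
        exact ⟨fun h => h hQ.1 hQ.2, fun h _ _ => h⟩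
      rw [hQ']
      exact isClosed_le continuous_const (continuous_id.dist continuous_const)
    · have hQ' : {P : ℂ × ℂ | Q ∈ DeArch.curve ℂ k → N k c Q = 0 → ρ ≤ dist P Q} = Set.univ := by
        ext P
        simp only [Set.mem_setOf_eq, Set.mem_univ, iff_true]
        exact fun h1 h2 => absurd ⟨h1, h2⟩ hQ
      rw [hQ']
      exact isClosed_univ
  set T : Set (ℂ × ℂ) := {P : ℂ × ℂ | P ∈ DeArch.curve ℂ k ∧ ‖N k c P‖ ≤ 1} ∩
    {P | ∀ Q ∈ DeArch.curve ℂ k, N k c Q = 0 → ρ ≤ dist P Q} with hT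
  have hTc : IsCompact T := (isCompact_sublevel k hc).inter_right hclosed
  by_cases hne : T.Nonempty
  · obtain ⟨P₀, hP₀T, hmin⟩ :=
      hTc.exists_isMinOn hne (continuous_norm.comp (continuous_N k c)).continuousOn
    have hpos : 0 < ‖N k c P₀‖ := by
      rw [norm_pos_iff]
      intro h0
      have := hP₀T.2 P₀ hP₀T.1.1 h0
      rw [dist_self] at this
      linarith
    refine ⟨min 1 ‖N k c P₀‖, lt_min one_pos hpos, fun P hP hsep => ?_⟩
    by_cases hle : ‖N k c P‖ ≤ 1
    · exact (min_le_right _ _).trans (hmin (show P ∈ T from ⟨⟨hP, hle⟩, hsep⟩))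
    · exact (min_le_left _ _).trans (not_le.mp hle).le
  · refine ⟨1, one_pos, fun P hP hsep => ?_⟩
    by_contra hlt
    exact hne ⟨P, ⟨hP, (not_le.mp hlt).le⟩, hsep⟩

/-- Monotone variant: separation from any set `Z` CONTAINING the zeros of `N_c` on `D_e(ℂ)` (e.g. the
fibre `E_φ = t_c⁻¹ B ⊇ R_{t_c}` of the properness package) suffices, with the same constant.
[cite: MochizukiGenEll2010, Thm 2.1 p.12] -/
theorem exists_pos_le_norm_N_of_separated_of_subset (k : ℕ) {c : ℂ} (hc : c ≠ 0) {ρ : ℝ}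
    (hρ : 0 < ρ) :
    ∃ δ : ℝ, 0 < δ ∧ ∀ Z : Set (ℂ × ℂ), {Q | Q ∈ DeArch.curve ℂ k ∧ N k c Q = 0} ⊆ Z →
      ∀ P ∈ DeArch.curve ℂ k, (∀ Q ∈ Z, ρ ≤ dist P Q) → δ ≤ ‖N k c P‖ := by
  obtain ⟨δ, hδ, h⟩ := exists_pos_le_norm_N_of_separated k hc hρ
  exact ⟨δ, hδ, fun Z hZ P hP hsep => h P hP fun Q hQ hQ0 => hsep Q (hZ ⟨hQ, hQ0⟩)⟩

/-- `x`-CURRENCY REDUCTION: if every zero of `N_c` on `D_e(ℂ)` has `x`-coordinate in a set `X ⊆ ℂ`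
(for the spine: `X = X_φ = x(t_c⁻¹ B)` with `B ⊇` the critical values of `t_c`), then `ρ`-separation
of the `x`-coordinate of `P` from `X` implies sup-distance `ρ`-separation of `P` from the zeros.
[cite: MochizukiGenEll2010, Thm 2.1 p.12] -/
theorem separated_of_fst_separated {c : ℂ} {X : Set ℂ}
    (hX : ∀ Q ∈ DeArch.curve ℂ k, N k c Q = 0 → Q.1 ∈ X) {ρ : ℝ} {P : ℂ × ℂ}
    (hsep : ∀ a ∈ X, ρ ≤ ‖P.1 - a‖) :
    ∀ Q ∈ DeArch.curve ℂ k, N k c Q = 0 → ρ ≤ dist P Q := by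
  intro Q hQ hN
  calc ρ ≤ ‖P.1 - Q.1‖ := hsep Q.1 (hX Q hQ hN)
    _ = dist P.1 Q.1 := (dist_eq_norm _ _).symm
    _ ≤ dist P Q := by rw [Prod.dist_eq]; exact le_max_left _ _

/-- LOWER BOUND UNDER `x`-SEPARATION from a set `X ⊇ x(zeros of N_c on D_e(ℂ))`, same constant.
[cite: MochizukiGenEll2010, Thm 2.1 p.12] -/
theorem exists_pos_le_norm_N_of_fst_separated (k : ℕ) {c : ℂ} (hc : c ≠ 0) {ρ : ℝ}
    (hρ : 0 < ρ) :
    ∃ δ : ℝ, 0 < δ ∧ ∀ X : Set ℂ, (∀ Q ∈ DeArch.curve ℂ k, N k c Q = 0 → Q.1 ∈ X) →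
      ∀ P ∈ DeArch.curve ℂ k, (∀ a ∈ X, ρ ≤ ‖P.1 - a‖) → δ ≤ ‖N k c P‖ := by
  obtain ⟨δ, hδ, h⟩ := exists_pos_le_norm_N_of_separated k hc hρ
  exact ⟨δ, hδ, fun X hX P hP hsep => h P hP (separated_of_fst_separated hX hsep)⟩

end Complex

end DeFamily

end Literature.NumberTheory.DiophantineGeometry.GenEll
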